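import Literature.Geometry.Riemannian.BamlerFCompactness
import Literature.Geometry.Riemannian.RicciFlowMetricFlowPairConcentration
import HarnessLib

/-!
# Bamler's 𝔽-compactness of Ricci flows from total boundedness and completeness
# (Bamler 2023, §7.3, proof of Thm. 7.4; §7.1, Cor. 7.5 with Lemma 7.3)

R. Bamler, *Compactness theory of the space of super Ricci flows*, Invent. Math. 233 (2023), §7.1,
Theorem 7.4 (arXiv v1 Thm. 155): "Assume that `I ⊂ ℝ` is a finite interval and suppose that
`J ⊂ I` is a finite subset. Let `H, V ≥ 0`, `r > 0` and `b : (0,1] → (0,1]` be a function. Then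
`𝔽^J_I(H, V, b, r)` is a compact subset of `(𝔽^J_I, d^J_𝔽)`", with the proof (§7.3): "By Lemma
[closedness, arXiv v1 Lemma 166] the subset `𝔽^J_I(H, V, b, r) ⊂ 𝔽^J_I` is closed, so by Theorem
[`(𝔽^J_I, d^J_𝔽)` is complete, arXiv v1 Thm. 120] it is complete. To see total boundedness,
suppose by contradiction that there is a sequence … with `d_𝔽(·,·) > ε r` for all `i ≠ j` …
[Lemmas 164, 165]"; and Corollary 7.5 (arXiv v1 Cor. 156): "Consider a sequence of super Ricci
flows `(M^i, (g^i_t)_{t ∈ I})` on compact `n`-dimensional manifolds together with a sequence of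
solutions to the conjugate heat equation … If `I` is a finite interval and `J` is finite, then
there is a subsequence, such that the corresponding sequence `(𝒳^i, (μ^i_t)_{t ∈ I})` of metric
flow pairs converges to a class of metric flows in `𝔽^J_I(H_n, V, b, r)` in the `d^J_𝔽`-sense",
obtained from Thm. 7.4 via Lemma 7.3 (arXiv v1 Lemma 154: the pair of a compact super Ricci flow
with a conjugate heat kernel measure lies in `𝔽^{*,J}_I(H_n)`).

This file proves the ASSEMBLY step of this argument for the tree's named fact
`bamler_FCompactness_ricciFlow` (BamlerFCompactness.lean: `J = ∅`, `I = [a, T]`, the conjugate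
heat kernel pairs `ricciFlowMetricFlowPair` of Ricci flows on closed connected `m`-manifolds,
universe `0`): `bamler_FCompactness_ricciFlow_of_totallyBounded_of_complete` derives the fact from
two abstract statements about sequences of `H`-concentrated metric flow pairs over `[a, T]`,
* TOTAL BOUNDEDNESS (§7.3, the total-boundedness half of the proof of Thm. 7.4, arXiv v1
  Lemmas 164–165, `J = ∅`): a sequence of `H`-concentrated pairs defined over `(a, T)` with
  uniformly bounded variances `Var(μ_t) ≤ C` has, for every `ε > 0`, a subsequence all of whose
  mutual `d_𝔽`-distances are `≤ ε`;
* COMPLETENESS (§5.4, arXiv v1 Thm. 120, with the closedness Lemma 166, `J = ∅`): a sequence of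
  `H`-concentrated pairs with measurable exceptional sets and `d_𝔽(P_n, P_{n+1}) < 2^{-n}`
  converges in `d_𝔽` to an `H`-concentrated pair with measurable exceptional set;
by the "complete + totally bounded ⇒ sequentially compact" diagonal argument: the pairs `Q_k` of
the given Ricci flows are `H_m`-concentrated with `Var(μ_s) ≤ H_m (T − s) ≤ H_m (T − a)`
(Lemma 7.3: `ricciFlowMetricFlowPair_isHConcentrated`, `variance_ricciFlowMetricFlowPair_measure_le`)
and defined over `(a, T)`; total boundedness applied successively with `ε = 2^{-(k+1)}` to nested
subsequences and the diagonal give `σ` strictly increasing with `d_𝔽(Q_{σ k}, Q_{σ (k+1)}) < 2^{-k}`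
(`exists_strictMono_lt_two_inv_pow_of_subseq`), and completeness gives the limit. The two
hypotheses are the subject of other files; nothing is assumed here.

## References

* R. H. Bamler, *Compactness theory of the space of super Ricci flows*, Invent. Math. 233 (2023),
  1121–1277 (arXiv:2008.09298), §7.3, proof of Thm. 7.4 (arXiv v1 Thm. 155, Lemmas 164–166);
  §7.1 Cor. 7.5, Lemma 7.3 (arXiv v1 Cor. 156, Lemma 154); §5.4 Thm. (completeness, arXiv v1
  Thm. 120). [Bamler2023]
-/

noncomputable section

open Set MeasureTheory Filter TopologicalSpace Function
open scoped Topology ENNReal NNReal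

namespace Literature.Geometry.Riemannian

/-- `2^{-(k+1)} < 2^{-k}` in `ℝ≥0∞`. [folklore] -/
theorem two_inv_pow_succ_lt (k : ℕ) : (2⁻¹ : ℝ≥0∞) ^ (k + 1) < 2⁻¹ ^ k := by
  rw [pow_succ, ← div_eq_mul_inv]
  exact ENNReal.half_lt_self (ENNReal.pow_pos (by norm_num) _).ne'
    (ENNReal.pow_ne_top (ENNReal.inv_ne_top.2 two_ne_zero))

/-- **Diagonal extraction of a fast Cauchy subsequence from total boundedness** (the
"complete + totally bounded ⇒ compact" step of Bamler 2023, §7.3, proof of Thm. 7.4, in abstract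
form): if every reindexing `ψ` of a sequence admits, for every `ε > 0`, a subsequence `ψ ∘ φ` all
of whose mutual `G`-distances are `≤ ε`, then there is a strictly increasing `σ` with
`G (σ k) (σ (k + 1)) < 2^{-k}` for all `k` — the diagonal `σ k := Ψ_k (k)` of the nested
subsequences `Ψ_0 := φ_0`, `Ψ_{k+1} := Ψ_k ∘ φ_{k+1}` chosen for `ε = 2^{-(k+1)}`. [folklore] -/
theorem exists_strictMono_lt_two_inv_pow_of_subseq {G : ℕ → ℕ → ℝ≥0∞}
    (hTB : ∀ (ψ : ℕ → ℕ) (ε : ℝ≥0∞), 0 < ε →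
      ∃ φ : ℕ → ℕ, StrictMono φ ∧ ∀ i j, G (ψ (φ i)) (ψ (φ j)) ≤ ε) :
    ∃ σ : ℕ → ℕ, StrictMono σ ∧ ∀ k, G (σ k) (σ (k + 1)) < 2⁻¹ ^ k := by
  have hpos : ∀ k : ℕ, (0 : ℝ≥0∞) < 2⁻¹ ^ (k + 1) := fun k ↦ ENNReal.pow_pos (by norm_num) _
  choose Φ hΦm hΦd using fun (ψ : ℕ → ℕ) (k : ℕ) ↦ hTB ψ (2⁻¹ ^ (k + 1)) (hpos k)
  -- the nested subsequences `Ψ 0 := Φ id 0`, `Ψ (k + 1) := Ψ k ∘ Φ (Ψ k) (k + 1)`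
  obtain ⟨Ψ, hΨ0, hΨs⟩ : ∃ Ψ : ℕ → ℕ → ℕ,
      Ψ 0 = Φ id 0 ∧ ∀ k, Ψ (k + 1) = Ψ k ∘ Φ (Ψ k) (k + 1) :=
    ⟨fun k ↦ Nat.rec (Φ id 0) (fun k ψ ↦ ψ ∘ Φ ψ (k + 1)) k, rfl, fun _ ↦ rfl⟩
  have hΨm : ∀ k, StrictMono (Ψ k) := by
    intro k
    induction k with
    | zero => rw [hΨ0]; exact hΦm id 0
    | succ k ih => rw [hΨs]; exact ih.comp (hΦm _ _)
  have hΨd : ∀ k i j, G (Ψ k i) (Ψ k j) ≤ 2⁻¹ ^ (k + 1) := by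
    intro k i j
    cases k with
    | zero => rw [hΨ0]; exact hΦd id 0 i j
    | succ k => rw [hΨs]; exact hΦd (Ψ k) (k + 1) i j
  -- the diagonal `σ k := Ψ k k`
  refine ⟨fun k ↦ Ψ k k, strictMono_nat_of_lt_succ fun k ↦ ?_, fun k ↦ ?_⟩
  · show Ψ k k < Ψ (k + 1) (k + 1)
    rw [hΨs k]
    exact hΨm k (k.lt_succ_self.trans_le (hΦm (Ψ k) (k + 1)).le_apply)
  · show G (Ψ k k) (Ψ (k + 1) (k + 1)) < 2⁻¹ ^ k
    rw [hΨs k]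
    exact (hΨd k k _).trans_lt (two_inv_pow_succ_lt k)

/-- `H_m = (m − 1)π²/2 + 4 ≥ 0` for `m ≥ 1`. [cite: Bamler2023, §3.7, Theorem (super Ricci flows as metric flows)] -/
theorem concentrationConst_nonneg {m : ℕ} (hm : 0 < m) : 0 ≤ MetricFlow.concentrationConst m := by
  have h1 : (1 : ℝ) ≤ m := by exact_mod_cast hm
  have h2 : 0 ≤ ((m : ℝ) - 1) * Real.pi ^ 2 / 2 :=
    div_nonneg (mul_nonneg (by linarith only [h1]) (sq_nonneg _)) zero_le_two
  rw [MetricFlow.concentrationConst]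
  linarith only [h2]

/-- **Bamler's 𝔽-compactness of compact Ricci flows with conjugate heat kernels (Cor. 7.5 with
Thm. 7.4 and Lemma 7.3, `J = ∅`) from total boundedness and completeness.** Assume
(TOTAL BOUNDEDNESS, §7.3) that every sequence of `H`-concentrated metric flow pairs over `[a, T]`
defined over `(a, T)` with `Var(μ_t) ≤ C` has, for every `ε > 0`, a subsequence with all mutual
`d_𝔽`-distances `≤ ε`, and (COMPLETENESS, §5.4 with the closedness of `𝔽_I(H)`) that every
sequence of `H`-concentrated pairs over `[a, T]` with measurable exceptional sets and
`d_𝔽(P_n, P_{n+1}) < 2^{-n}` has an `H`-concentrated `d_𝔽`-limit with measurable exceptional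
set. Then `bamler_FCompactness_ricciFlow` holds: the pairs `Q_k = (𝒳^k, (ν_{x_k,T;s})_{s ∈ (a,T)})`
of a sequence of Ricci flows on closed connected `m`-manifolds over `[a, T]` are
`H_m`-concentrated with `Var(ν_{x_k,T;s}) ≤ H_m (T − s) ≤ H_m (T − a)` (Lemma 7.3), so nested
applications of total boundedness with `ε = 2^{-(k+1)}` and a diagonal extraction
(`exists_strictMono_lt_two_inv_pow_of_subseq`) give a subsequence `σ` with
`d_𝔽(Q_{σ k}, Q_{σ (k+1)}) < 2^{-k}`, which converges by completeness ("complete + totally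
bounded ⇒ compact", the proof of Thm. 7.4).
[cite: Bamler2023, §7.3, proof of Thm 7.4 (arXiv v1 Thm 155); §7.1 Cor 7.5, Lemma 7.3] -/
theorem bamler_FCompactness_ricciFlow_of_totallyBounded_of_complete
    (hTB : ∀ (H C a T : ℝ), 0 ≤ H → a < T → ∀ P : ℕ → MetricFlowPair.{0} (Icc a T),
      (∀ n, (P n).flow.IsHConcentrated H) → (∀ n, Ioo a T ⊆ (P n).I') →
      (∀ n (t : (P n).I'), variance ((P n).μ t) ((P n).μ t) ≤ ENNReal.ofReal C) →
      ∀ ε : ℝ≥0∞, 0 < ε → ∃ φ : ℕ → ℕ, StrictMono φ ∧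
        ∀ i j, MetricFlowPair.fDist ∅ (P (φ i)) (P (φ j)) ≤ ε)
    (hCP : ∀ (H a T : ℝ), 0 ≤ H → a < T → ∀ P : ℕ → MetricFlowPair.{0} (Icc a T),
      (∀ n, (P n).flow.IsHConcentrated H) → (∀ n, MeasurableSet (Icc a T \ (P n).I')) →
      (∀ n, MetricFlowPair.fDist ∅ (P n) (P (n + 1)) < 2⁻¹ ^ n) →
      ∃ Pinf : MetricFlowPair.{0} (Icc a T), Pinf.flow.IsHConcentrated H ∧
        MeasurableSet (Icc a T \ Pinf.I') ∧
        Tendsto (fun n ↦ MetricFlowPair.fDist ∅ (P n) Pinf) atTop (𝓝 0)) :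
    bamler_FCompactness_ricciFlow := by
  intro m hm a T haT M _ _ _ _ _ _ _ _ _ h cov hflow hh hR x
  -- the pairs of the flows (Lemma 7.3): `H_m`-concentrated, `Var ≤ H_m (T - a)`, over `(a, T)`
  set Q : ℕ → MetricFlowPair.{0} (Icc a T) := fun k ↦
    ricciFlowMetricFlowPair (hh k) (hR k) (hflow k) haT (x k) with hQ
  have hH : 0 ≤ MetricFlow.concentrationConst m := concentrationConst_nonneg hm
  have hQH : ∀ k, (Q k).flow.IsHConcentrated (MetricFlow.concentrationConst m) := fun k ↦
    ricciFlowMetricFlowPair_isHConcentrated hm (hflow k) (hh k) (hR k) haT (x k)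
  have hQI : ∀ k, Ioo a T ⊆ (Q k).I' := fun _ ↦ Subset.rfl
  have hQV : ∀ (k) (t : (Q k).I'), variance ((Q k).μ t) ((Q k).μ t) ≤
      ENNReal.ofReal (MetricFlow.concentrationConst m * (T - a)) := by
    intro k t
    have ht : (t : ℝ) ∈ Ioo a T := t.2
    exact (variance_ricciFlowMetricFlowPair_measure_le hm (hflow k) (hh k) (hR k) haT (x k) t).trans
      (ENNReal.ofReal_le_ofReal (mul_le_mul_of_nonneg_left (by linarith only [ht.1]) hH))
  have hQM : ∀ k, MeasurableSet (Icc a T \ (Q k).I') := fun k ↦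
    measurableSet_Icc_diff_ricciFlowMetricFlowPair_I' (hh k) (hR k) (hflow k) haT (x k)
  -- Step 1 (total boundedness and the diagonal argument): `d_F(Q (σ k), Q (σ (k+1))) < 2^{-k}`
  obtain ⟨σ, hσ, hfast⟩ := exists_strictMono_lt_two_inv_pow_of_subseq
    (G := fun i j ↦ MetricFlowPair.fDist ∅ (Q i) (Q j)) fun ψ ε hε ↦
      hTB (MetricFlow.concentrationConst m) (MetricFlow.concentrationConst m * (T - a)) a T hH
        haT (fun n ↦ Q (ψ n)) (fun n ↦ hQH (ψ n)) (fun n ↦ hQI (ψ n)) (fun n ↦ hQV (ψ n)) ε hε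
  -- Step 2 (completeness): the `H_m`-concentrated limit of the fast Cauchy subsequence
  obtain ⟨P, hPH, -, hPT⟩ := hCP (MetricFlow.concentrationConst m) a T hH haT (fun n ↦ Q (σ n))
    (fun n ↦ hQH (σ n)) (fun n ↦ hQM (σ n)) hfast
  exact ⟨σ, hσ, P, hPH, hPT⟩

end Literature.Geometry.Riemannian

end
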